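import Mathlib
import Summits.KontsevichZagierPeriods.KontsevichZagierPeriods.Theorems.InverseLandauTateFamilyKernelStubGvCertificate

/-!
# Crux `TateFamilyKernel` (stmt-KontsevichZagierPeriods-9130), line `Sketch`:
# stub `stub_gwCertificate`

Step GW4 (CERTIFICATE, pure algebra) of the general-slope graph-pencil class of the lead's
skeleton of the crux
`Summit.KontsevichZagierPeriods.KontsevichZagierPeriods.Theses.InverseLandau.TateFamilyKernel`.
Variables: `X 0 = z₁`, `X 1 = z₂`, `X 2 = ϖ`; slope `V = v(z₂)` (`Polynomial.aeval (X 1) v`),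
twisted coefficient `L = u′(z₂) + v′(z₂) z₁`, Tate denominator
`Q = 1 − ϖ·(u(z₂) + V z₁) ∈ ℚ[z₁, z₂, ϖ]` with `u v ∈ ℚ[s]`.

If the `ϖ`-free numerator satisfies the TWISTED IDENTITY
`V^m P = L·∂₀Ñ − V·∂₁Ñ + m v′·Ñ` for a polynomial `Ñ ∈ ℚ[z₁,z₂]`, then `P/Q` is Griffiths-exact
with the polynomial denominator `D = Q·V^m`:
`P/Q = ∂₀(LÑ/D) + ∂₁(−VÑ/D)`. Indeed `∂₀Q = −ϖV`, `∂₁Q = −ϖL` make the two `Q⁻²` cross terms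
`±ϖVLÑ` cancel, `∂₀V^m = 0`, and `V·∂₁V^m = m v′·V^m` produces exactly the zeroth-order term of
the twisted identity. The statement is the pointwise form of this identity at a real point
`(w, ϖ)` where `Q ≠ 0` and `v(w 1) ≠ 0`, with both quotient-rule numerators written out
(`∂ᵢ(Aᵢ/D) = (∂ᵢAᵢ·D − Aᵢ·∂ᵢD)/D²`, `A₀ = LÑ`, `A₁ = −VÑ`, lifted to three variables by
`rename Fin.castSucc`).

Proof: the polynomial identities `∂₀Q = −(ϖ·V)`, `∂₁Q = −(ϖ·L)`, `∂₀V = 0`, `∂₁V = v′(z₂)`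
(chain rule `GpCertificate.pderiv_polyAeval_self/_of_ne`), `∂₁V^m = m V^(m-1) v′`
(`MvPolynomial.pderiv_pow`), `∂ᵢ ∘ rename castSucc = rename castSucc ∘ ∂ᵢ` (sibling file
`…StubGpCertificate`); after evaluating by the algebra map `aeval (Fin.snoc w ϖ)` and substituting
`P = (…)/V^m` from the evaluated twisted identity, the claim is a field identity in real atoms:
clear the denominators `V^m·Q` and `(Q·V^m)²` (`div_eq_div_iff`), then `ring` (after `cases m` to
dispose of the truncated exponent `m - 1`). This is the sibling certificate
`stub_gvCertificate` (linear slope `γ + δ z₂`) with `γ + δ z₂ ↦ v(z₂)` and `δ ↦ v′(z₂)`.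

References: Kontsevich–Zagier 2001, §1.2 (an elementary algebraic step of one test class of the
period conjecture). Mathlib and the two sibling certificate files only; no named fact, no new
definition. Helpers live in the sub-namespace `GwCertificate`.
-/

noncomputable section

open MvPolynomial

namespace Summit.KontsevichZagierPeriods.InverseLandau.TateFamilyKernel.Descent

namespace GwCertificate

/-! ### The twisted coefficient `L = u′(z₂) + v′(z₂) z₁` -/

/-- `∂₀ L = v′(X₁)` for the twisted coefficient `L = u′(X₁) + v′(X₁) X₀`. [folklore] -/
theorem pderiv_zero_gwL (u v : Polynomial ℚ) :
    pderiv 0 (Polynomial.aeval (X 1 : MvPolynomial (Fin (2 + 1)) ℚ) (Polynomial.derivative u) +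
        Polynomial.aeval (X 1 : MvPolynomial (Fin (2 + 1)) ℚ) (Polynomial.derivative v) * X 0) =
      Polynomial.aeval (X 1 : MvPolynomial (Fin (2 + 1)) ℚ) (Polynomial.derivative v) := by
  have h10 : (1 : Fin (2 + 1)) ≠ 0 := by decide
  rw [map_add, GpCertificate.pderiv_polyAeval_of_ne h10, pderiv_mul,
    GpCertificate.pderiv_polyAeval_of_ne h10, pderiv_X_self, zero_mul, zero_add, mul_one, zero_add]

/-! ### The partial derivatives of the Tate denominator `Q = 1 − ϖ(u(z₂) + v(z₂) z₁)` -/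

/-- `∂₀ Q = −ϖ v(X₁)` for `Q = 1 − X₂·(u(X₁) + v(X₁) X₀)`. [folklore] -/
theorem pderiv_zero_gwQ (u v : Polynomial ℚ) :
    pderiv 0 (1 - X 2 * (Polynomial.aeval (X 1 : MvPolynomial (Fin (2 + 1)) ℚ) u +
        Polynomial.aeval (X 1 : MvPolynomial (Fin (2 + 1)) ℚ) v * X 0)) =
      -(X 2 * Polynomial.aeval (X 1 : MvPolynomial (Fin (2 + 1)) ℚ) v) := by
  have h10 : (1 : Fin (2 + 1)) ≠ 0 := by decide
  have h20 : (2 : Fin (2 + 1)) ≠ 0 := by decide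
  rw [map_sub, Derivation.map_one_eq_zero, pderiv_mul, pderiv_X_of_ne h20, map_add,
    GpCertificate.pderiv_polyAeval_of_ne h10, pderiv_mul,
    GpCertificate.pderiv_polyAeval_of_ne h10, pderiv_X_self]
  ring

/-- `∂₁ Q = −ϖ·(u′(X₁) + v′(X₁) X₀)` for `Q = 1 − X₂·(u(X₁) + v(X₁) X₀)`. [folklore] -/
theorem pderiv_one_gwQ (u v : Polynomial ℚ) :
    pderiv 1 (1 - X 2 * (Polynomial.aeval (X 1 : MvPolynomial (Fin (2 + 1)) ℚ) u +
        Polynomial.aeval (X 1 : MvPolynomial (Fin (2 + 1)) ℚ) v * X 0)) =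
      -(X 2 * (Polynomial.aeval (X 1 : MvPolynomial (Fin (2 + 1)) ℚ) (Polynomial.derivative u) +
        Polynomial.aeval (X 1 : MvPolynomial (Fin (2 + 1)) ℚ) (Polynomial.derivative v) * X 0)) := by
  have h01 : (0 : Fin (2 + 1)) ≠ 1 := by decide
  have h21 : (2 : Fin (2 + 1)) ≠ 1 := by decide
  rw [map_sub, Derivation.map_one_eq_zero, pderiv_mul, pderiv_X_of_ne h21, map_add,
    GpCertificate.pderiv_polyAeval_self, pderiv_mul, GpCertificate.pderiv_polyAeval_self,
    pderiv_X_of_ne h01]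
  ring

/-! ### Lifting from `ℚ[z₁,z₂]` to `ℚ[z₁,z₂,ϖ]` by `rename Fin.castSucc` -/

/-- The lift of a power of the slope: `rename castSucc (v(X₁)^m) = v(X₁)^m`. [folklore] -/
theorem rename_gwV_pow (v : Polynomial ℚ) (m : ℕ) :
    (rename Fin.castSucc ((Polynomial.aeval (X 1 : MvPolynomial (Fin 2) ℚ) v) ^ m) :
        MvPolynomial (Fin (2 + 1)) ℚ) =
      (Polynomial.aeval (X 1 : MvPolynomial (Fin (2 + 1)) ℚ) v) ^ m := by
  rw [map_pow, GpCertificate.rename_polyAeval]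

/-- The lift of the twisted coefficient:
`rename castSucc (u′(X₁) + v′(X₁) X₀) = u′(X₁) + v′(X₁) X₀`. [folklore] -/
theorem rename_gwL (u v : Polynomial ℚ) :
    (rename Fin.castSucc
        (Polynomial.aeval (X 1 : MvPolynomial (Fin 2) ℚ) (Polynomial.derivative u) +
          Polynomial.aeval (X 1 : MvPolynomial (Fin 2) ℚ) (Polynomial.derivative v) * X 0) :
          MvPolynomial (Fin (2 + 1)) ℚ) =
      Polynomial.aeval (X 1 : MvPolynomial (Fin (2 + 1)) ℚ) (Polynomial.derivative u) +
        Polynomial.aeval (X 1 : MvPolynomial (Fin (2 + 1)) ℚ) (Polynomial.derivative v) * X 0 := by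
  rw [map_add, map_mul, GpCertificate.rename_polyAeval, GpCertificate.rename_polyAeval, rename_X,
    Fin.castSucc_zero]

/-- The lifted datum `A₀ = L·Ñ`: `rename castSucc (L Ñ) = L · rename castSucc Ñ`,
`L = u′(X₁) + v′(X₁) X₀`. [folklore] -/
theorem rename_gwA0 (u v : Polynomial ℚ) (N : MvPolynomial (Fin 2) ℚ) :
    (rename Fin.castSucc
        ((Polynomial.aeval (X 1 : MvPolynomial (Fin 2) ℚ) (Polynomial.derivative u) +
            Polynomial.aeval (X 1 : MvPolynomial (Fin 2) ℚ) (Polynomial.derivative v) * X 0) * N) :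
          MvPolynomial (Fin (2 + 1)) ℚ) =
      (Polynomial.aeval (X 1 : MvPolynomial (Fin (2 + 1)) ℚ) (Polynomial.derivative u) +
          Polynomial.aeval (X 1 : MvPolynomial (Fin (2 + 1)) ℚ) (Polynomial.derivative v) * X 0) *
        rename Fin.castSucc N := by
  rw [map_mul, rename_gwL]

/-- `∂₀` of the lifted datum `A₀ = L·Ñ`: `∂₀(L Ñ) = v′(X₁) Ñ + L ∂₀Ñ`. [folklore] -/
theorem pderiv_zero_gwA0 (u v : Polynomial ℚ) (N : MvPolynomial (Fin 2) ℚ) :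
    pderiv 0 ((Polynomial.aeval (X 1 : MvPolynomial (Fin (2 + 1)) ℚ) (Polynomial.derivative u) +
        Polynomial.aeval (X 1 : MvPolynomial (Fin (2 + 1)) ℚ) (Polynomial.derivative v) * X 0) *
          rename Fin.castSucc N) =
      Polynomial.aeval (X 1 : MvPolynomial (Fin (2 + 1)) ℚ) (Polynomial.derivative v) *
          rename Fin.castSucc N +
        (Polynomial.aeval (X 1 : MvPolynomial (Fin (2 + 1)) ℚ) (Polynomial.derivative u) +
            Polynomial.aeval (X 1 : MvPolynomial (Fin (2 + 1)) ℚ) (Polynomial.derivative v) * X 0) *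
          rename Fin.castSucc (pderiv 0 N) := by
  rw [pderiv_mul, pderiv_zero_gwL, GpCertificate.pderiv_zero_rename]

/-- The lifted datum `A₁ = −V·Ñ`: `rename castSucc (−(v(X₁) Ñ)) = −(v(X₁) · rename castSucc Ñ)`.
[folklore] -/
theorem rename_gwA1 (v : Polynomial ℚ) (N : MvPolynomial (Fin 2) ℚ) :
    (rename Fin.castSucc (-(Polynomial.aeval (X 1 : MvPolynomial (Fin 2) ℚ) v * N)) :
        MvPolynomial (Fin (2 + 1)) ℚ) =
      -(Polynomial.aeval (X 1 : MvPolynomial (Fin (2 + 1)) ℚ) v * rename Fin.castSucc N) := by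
  rw [map_neg, map_mul, GpCertificate.rename_polyAeval]

/-- `∂₁` of the lifted datum `A₁ = −V·Ñ`: `∂₁(−v(X₁) Ñ) = −(v′(X₁) Ñ + v(X₁) ∂₁Ñ)`. [folklore] -/
theorem pderiv_one_gwA1 (v : Polynomial ℚ) (N : MvPolynomial (Fin 2) ℚ) :
    pderiv 1 (-(Polynomial.aeval (X 1 : MvPolynomial (Fin (2 + 1)) ℚ) v * rename Fin.castSucc N)) =
      -(Polynomial.aeval (X 1 : MvPolynomial (Fin (2 + 1)) ℚ) (Polynomial.derivative v) *
            rename Fin.castSucc N +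
          Polynomial.aeval (X 1 : MvPolynomial (Fin (2 + 1)) ℚ) v *
            rename Fin.castSucc (pderiv 1 N)) := by
  rw [map_neg, pderiv_mul, GpCertificate.pderiv_polyAeval_self, GpCertificate.pderiv_one_rename]

/-! ### The partial derivatives of the Griffiths denominator `D = Q · v(z₂)^m` -/

/-- `∂₀ D = −ϖV · V^m` for `D = Q · V^m`, `V = v(X₁)` (`∂₀ V^m = 0`). [folklore] -/
theorem pderiv_zero_gwD (u v : Polynomial ℚ) (m : ℕ) :
    pderiv 0 ((1 - X 2 * (Polynomial.aeval (X 1 : MvPolynomial (Fin (2 + 1)) ℚ) u +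
        Polynomial.aeval (X 1 : MvPolynomial (Fin (2 + 1)) ℚ) v * X 0)) *
          Polynomial.aeval (X 1 : MvPolynomial (Fin (2 + 1)) ℚ) v ^ m) =
      -(X 2 * Polynomial.aeval (X 1 : MvPolynomial (Fin (2 + 1)) ℚ) v) *
        Polynomial.aeval (X 1 : MvPolynomial (Fin (2 + 1)) ℚ) v ^ m := by
  have h10 : (1 : Fin (2 + 1)) ≠ 0 := by decide
  rw [pderiv_mul, pderiv_zero_gwQ, pderiv_pow, GpCertificate.pderiv_polyAeval_of_ne h10, mul_zero,
    mul_zero, add_zero]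

/-- `∂₁ D = −ϖL · V^m + Q · (m V^(m-1) v′(X₁))` for `D = Q · V^m`, `V = v(X₁)`. [folklore] -/
theorem pderiv_one_gwD (u v : Polynomial ℚ) (m : ℕ) :
    pderiv 1 ((1 - X 2 * (Polynomial.aeval (X 1 : MvPolynomial (Fin (2 + 1)) ℚ) u +
        Polynomial.aeval (X 1 : MvPolynomial (Fin (2 + 1)) ℚ) v * X 0)) *
          Polynomial.aeval (X 1 : MvPolynomial (Fin (2 + 1)) ℚ) v ^ m) =
      -(X 2 * (Polynomial.aeval (X 1 : MvPolynomial (Fin (2 + 1)) ℚ) (Polynomial.derivative u) +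
            Polynomial.aeval (X 1 : MvPolynomial (Fin (2 + 1)) ℚ) (Polynomial.derivative v) * X 0)) *
          Polynomial.aeval (X 1 : MvPolynomial (Fin (2 + 1)) ℚ) v ^ m +
        (1 - X 2 * (Polynomial.aeval (X 1 : MvPolynomial (Fin (2 + 1)) ℚ) u +
            Polynomial.aeval (X 1 : MvPolynomial (Fin (2 + 1)) ℚ) v * X 0)) *
          ((m : MvPolynomial (Fin (2 + 1)) ℚ) *
              Polynomial.aeval (X 1 : MvPolynomial (Fin (2 + 1)) ℚ) v ^ (m - 1) *
            Polynomial.aeval (X 1 : MvPolynomial (Fin (2 + 1)) ℚ) (Polynomial.derivative v)) := by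
  rw [pderiv_mul, pderiv_one_gwQ, pderiv_pow, GpCertificate.pderiv_polyAeval_self]

/-- The slope evaluated at the extended point: `(v(X₁))(snoc w ϖ) = v(w 1)`. [folklore] -/
theorem aeval_snoc_gwV (v : Polynomial ℚ) (ϖ : ℝ) (w : Fin 2 → ℝ) :
    aeval (Fin.snoc w ϖ : Fin (2 + 1) → ℝ) (Polynomial.aeval (X 1 : MvPolynomial (Fin (2 + 1)) ℚ) v) =
      Polynomial.aeval (w 1) v := by
  rw [← Polynomial.aeval_algHom_apply, MvPolynomial.aeval_X, GvCertificate.snoc_one]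

end GwCertificate

/-- STUB `stub_gwCertificate` (general-slope graph-pencil class, step GW4: CERTIFICATE, pure
algebra). The twisted identity `V^m P = L ∂₀Ñ − V ∂₁Ñ + m v′ Ñ` (`V = v(z₂)`,
`L = u′(z₂) + v′(z₂)z₁`) makes `P/Q` Griffiths-exact with denominator `D = Q·V^m`,
`Q = 1 − ϖ(u(z₂) + Vz₁)`: `P/Q = ∂₀(LÑ/D) + ∂₁(−VÑ/D)` pointwise wherever `Q ≠ 0` and `V ≠ 0`
(the `Q⁻²` cross terms `±ϖVLÑ` cancel since `∂₀Q = −ϖV`, `∂₁Q = −ϖL`, and `V ∂₁V^m = m v′ V^m`),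
written with both quotient-rule numerators spelled out and the data `A = (LÑ, −VÑ)` lifted by
`rename Fin.castSucc`. [cite: KontsevichZagier2001, §1.2] -/
theorem stub_gwCertificate (u v : Polynomial ℚ) (P Nt : MvPolynomial (Fin 2) ℚ) (m : ℕ)
    (hN : Polynomial.aeval (X 1 : MvPolynomial (Fin 2) ℚ) v ^ m * P =
        (Polynomial.aeval (X 1 : MvPolynomial (Fin 2) ℚ) (Polynomial.derivative u) +
            Polynomial.aeval (X 1 : MvPolynomial (Fin 2) ℚ) (Polynomial.derivative v) * X 0) * pderiv 0 Nt -
          Polynomial.aeval (X 1 : MvPolynomial (Fin 2) ℚ) v * pderiv 1 Nt +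
          C (m : ℚ) * Polynomial.aeval (X 1 : MvPolynomial (Fin 2) ℚ) (Polynomial.derivative v) * Nt)
    (ϖ : ℝ) (w : Fin 2 → ℝ) (hvw : Polynomial.aeval (w 1) v ≠ 0)
    (hQ : aeval (Fin.snoc w ϖ : Fin (2 + 1) → ℝ)
      (1 - X 2 * (Polynomial.aeval (X 1 : MvPolynomial (Fin (2 + 1)) ℚ) u +
        Polynomial.aeval (X 1 : MvPolynomial (Fin (2 + 1)) ℚ) v * X 0)) ≠ 0) :
    aeval (Fin.snoc w ϖ : Fin (2 + 1) → ℝ) (rename Fin.castSucc P) /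
        aeval (Fin.snoc w ϖ : Fin (2 + 1) → ℝ)
          (1 - X 2 * (Polynomial.aeval (X 1 : MvPolynomial (Fin (2 + 1)) ℚ) u +
            Polynomial.aeval (X 1 : MvPolynomial (Fin (2 + 1)) ℚ) v * X 0)) =
      aeval (Fin.snoc w ϖ : Fin (2 + 1) → ℝ)
          (pderiv 0 (rename Fin.castSucc
              ((Polynomial.aeval (X 1 : MvPolynomial (Fin 2) ℚ) (Polynomial.derivative u) +
                  Polynomial.aeval (X 1 : MvPolynomial (Fin 2) ℚ) (Polynomial.derivative v) * X 0) * Nt)) *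
              ((1 - X 2 * (Polynomial.aeval (X 1 : MvPolynomial (Fin (2 + 1)) ℚ) u +
                  Polynomial.aeval (X 1 : MvPolynomial (Fin (2 + 1)) ℚ) v * X 0)) *
                rename Fin.castSucc (Polynomial.aeval (X 1 : MvPolynomial (Fin 2) ℚ) v ^ m)) -
            rename Fin.castSucc
                ((Polynomial.aeval (X 1 : MvPolynomial (Fin 2) ℚ) (Polynomial.derivative u) +
                    Polynomial.aeval (X 1 : MvPolynomial (Fin 2) ℚ) (Polynomial.derivative v) * X 0) * Nt) *
              pderiv 0 ((1 - X 2 * (Polynomial.aeval (X 1 : MvPolynomial (Fin (2 + 1)) ℚ) u +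
                  Polynomial.aeval (X 1 : MvPolynomial (Fin (2 + 1)) ℚ) v * X 0)) *
                rename Fin.castSucc (Polynomial.aeval (X 1 : MvPolynomial (Fin 2) ℚ) v ^ m))) /
        aeval (Fin.snoc w ϖ : Fin (2 + 1) → ℝ)
          (((1 - X 2 * (Polynomial.aeval (X 1 : MvPolynomial (Fin (2 + 1)) ℚ) u +
              Polynomial.aeval (X 1 : MvPolynomial (Fin (2 + 1)) ℚ) v * X 0)) *
            rename Fin.castSucc (Polynomial.aeval (X 1 : MvPolynomial (Fin 2) ℚ) v ^ m)) ^ 2) +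
      aeval (Fin.snoc w ϖ : Fin (2 + 1) → ℝ)
          (pderiv 1 (rename Fin.castSucc (-(Polynomial.aeval (X 1 : MvPolynomial (Fin 2) ℚ) v * Nt))) *
              ((1 - X 2 * (Polynomial.aeval (X 1 : MvPolynomial (Fin (2 + 1)) ℚ) u +
                  Polynomial.aeval (X 1 : MvPolynomial (Fin (2 + 1)) ℚ) v * X 0)) *
                rename Fin.castSucc (Polynomial.aeval (X 1 : MvPolynomial (Fin 2) ℚ) v ^ m)) -
            rename Fin.castSucc (-(Polynomial.aeval (X 1 : MvPolynomial (Fin 2) ℚ) v * Nt)) *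
              pderiv 1 ((1 - X 2 * (Polynomial.aeval (X 1 : MvPolynomial (Fin (2 + 1)) ℚ) u +
                  Polynomial.aeval (X 1 : MvPolynomial (Fin (2 + 1)) ℚ) v * X 0)) *
                rename Fin.castSucc (Polynomial.aeval (X 1 : MvPolynomial (Fin 2) ℚ) v ^ m))) /
        aeval (Fin.snoc w ϖ : Fin (2 + 1) → ℝ)
          (((1 - X 2 * (Polynomial.aeval (X 1 : MvPolynomial (Fin (2 + 1)) ℚ) u +
              Polynomial.aeval (X 1 : MvPolynomial (Fin (2 + 1)) ℚ) v * X 0)) *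
            rename Fin.castSucc (Polynomial.aeval (X 1 : MvPolynomial (Fin 2) ℚ) v ^ m)) ^ 2) := by
  -- polynomial-level computation of the four partial derivatives
  rw [GwCertificate.rename_gwA0, GwCertificate.rename_gwA1, GwCertificate.rename_gwV_pow,
    GwCertificate.pderiv_zero_gwA0, GwCertificate.pderiv_one_gwA1, GwCertificate.pderiv_zero_gwD,
    GwCertificate.pderiv_one_gwD]
  -- the twisted identity, lifted and evaluated at the point
  have hN' :=
    congrArg (fun F => aeval (Fin.snoc w ϖ : Fin (2 + 1) → ℝ) (rename Fin.castSucc F)) hN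
  simp only [map_mul, map_pow, map_add, map_sub, map_natCast] at hN'
  simp only [rename_X, Fin.castSucc_zero, GpCertificate.rename_polyAeval] at hN'
  -- evaluate the goal
  simp only [map_sub, map_add, map_mul, map_neg, map_pow, map_one, map_natCast,
    GwCertificate.aeval_snoc_gwV] at hQ hN' ⊢
  have hp := eq_div_of_mul_eq (pow_ne_zero m hvw) ((mul_comm _ _).trans hN')
  -- clear the denominators `V^m · Q` and `(Q · V^m)²`
  rw [hp, ← add_div, div_div, div_eq_div_iff (mul_ne_zero (pow_ne_zero m hvw) hQ)
    (pow_ne_zero 2 (mul_ne_zero hQ (pow_ne_zero m hvw)))]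
  cases m with
  | zero =>
    simp only [pow_zero, Nat.cast_zero, zero_mul, mul_zero, mul_one, add_zero]
    ring
  | succ n =>
    simp only [Nat.add_sub_cancel, Nat.cast_succ]
    ring

end Summit.KontsevichZagierPeriods.InverseLandau.TateFamilyKernel.Descent
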